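import Literature.AlgebraicGeometry.Resolution.BlowupResolutionCriterion
import Literature.AlgebraicGeometry.Resolution.BlowupsFlatBaseChange
import Literature.AlgebraicGeometry.Resolution.RegularLocalRingsFlatDescent
import Mathlib.AlgebraicGeometry.Morphisms.Flat
import HarnessLib

/-!
# A blowing up is a resolution if it is so after a flat covering base change

Topic: `Literature/AlgebraicGeometry/Resolution`. The descent step of resolution BY ONE BLOWING UP
along a descended ideal sheaf (the assembly of the ÉTALE KATO programme, Nizioł 2006 Cor. 5.7 via
Kato 1994 (10.4) on étale charts; also the standard "resolve étale-locally by a canonical centre"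
pattern): let `π : X' → X` be a blowing up along `J` (universal property `IsBlowup`), and
`e_k : V_k → X` a finite family of FLAT morphisms, jointly surjective. Blow-ups commute with flat
base change (Görtz–Wedhorn I, Prop. 13.91 (2), `IsBlowup.pullback_snd_of_flat`): `X' ×_X V_k → V_k`
is a blowing up along `e_k^* J`. Hence:

* `IsBlowup.isRegular_of_flat_cover` — if every blowing up of every `V_k` along `e_k^* J` has
  regular source, then `X'` is regular (regularity descends along the flat local homomorphisms
  `𝒪_{X',x'} → 𝒪_{X' ×_X V_k, z}`, Matsumura Thm. 23.7 (i));
* `dense_centreCompl_of_cover` — if the centres `V(e_k^* J) ⊆ V_k` are nowhere dense, so is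
  `V(J) ⊆ X` (any jointly surjective family of morphisms);
* `IsBlowup.isResolution_of_flat_cover` — the two together with finite type of `J`: `π` is a
  resolution of singularities.

References: [GortzWedhorn2020] Prop. 13.91 (2)–(4); [Matsumura1987] Thm. 23.7 (i);
[StacksProject] Tag 02NS.
-/

noncomputable section

open CategoryTheory CategoryTheory.Limits AlgebraicGeometry TopologicalSpace

namespace Literature.AlgebraicGeometry.Resolution

universe u

variable {X' X : Scheme.{u}} {π : X' ⟶ X} {J : X.IdealSheafData}
  {κ : Type*} {V : κ → Scheme.{u}} (e : ∀ k, V k ⟶ X)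

/-- **Regularity of a blowing up is detected after a flat covering base change.** Let `π` be a
blowing up of `X` along `J`, `e_k : V_k → X` flat and jointly surjective, `X'` locally Noetherian.
If for every `k` every blowing up of `V_k` along `e_k^* J` has regular source, then `X'` is
regular: the base change `X' ×_X V_k → V_k` is such a blowing up (GW Prop. 13.91 (2)), the
projection `X' ×_X V_k → X'` is flat, every point of `X'` lies under one of them, and regularity
descends along flat local homomorphisms (Matsumura 23.7 (i)).
[cite: GortzWedhorn2020, Prop. 13.91 (2)] [cite: Matsumura1987, Thm. 23.7 (i)] -/
theorem IsBlowup.isRegular_of_flat_cover [IsLocallyNoetherian X'] (hπ : IsBlowup π J)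
    [∀ k, Flat (e k)] (hsurj : ∀ x : X, ∃ (k : κ) (v : V k), (e k).base v = x)
    (hreg : ∀ (k : κ) {P : Scheme.{u}} (q : P ⟶ V k), IsBlowup q (J.comap (e k)) →
      Scheme.IsRegular P) :
    Scheme.IsRegular X' := by
  intro x'
  obtain ⟨k, v, hv⟩ := hsurj (π.base x')
  -- a point of `X' ×_X V_k` over `(x', v)`
  obtain ⟨z, hz, -⟩ := Scheme.Pullback.exists_preimage_pullback x' v hv.symm
  have hP : Scheme.IsRegular (pullback π (e k)) := hreg k (pullback.snd π (e k))
    (hπ.pullback_snd_of_flat (e k))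
  -- regularity descends along the flat local map `𝒪_{X',x'} → 𝒪_{P,z}`
  subst hz
  letI := ((pullback.fst π (e k)).stalkMap z).hom.toAlgebra
  haveI : Module.Flat (X'.presheaf.stalk ((pullback.fst π (e k)).base z))
      ((pullback π (e k)).presheaf.stalk z) := Flat.stalkMap (pullback.fst π (e k)) z
  haveI : IsLocalHom (algebraMap (X'.presheaf.stalk ((pullback.fst π (e k)).base z))
      ((pullback π (e k)).presheaf.stalk z)) :=
    inferInstanceAs (IsLocalHom ((pullback.fst π (e k)).stalkMap z).hom)
  haveI : IsRegularLocalRing ((pullback π (e k)).presheaf.stalk z) := hP z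
  exact IsRegularLocalRing.of_flat_of_isLocalHom (X'.presheaf.stalk ((pullback.fst π (e k)).base z))
    ((pullback π (e k)).presheaf.stalk z)

/-- **Nowhere dense centre is detected on a covering family**: if the `e_k : V_k → X` are jointly
surjective and each `V_k ∖ V(e_k^* J)` is dense in `V_k`, then `X ∖ V(J)` is dense in `X`
(`V(e_k^* J) = e_k⁻¹ V(J)`, Mathlib `support_comap`). [folklore] -/
private theorem dense_centreCompl_of_cover (J : X.IdealSheafData)
    (hsurj : ∀ x : X, ∃ (k : κ) (v : V k), (e k).base v = x)
    (hdense : ∀ k, Dense ((centreCompl (J.comap (e k)) : (V k).Opens) : Set (V k))) :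
    Dense ((centreCompl J : X.Opens) : Set X) := by
  rw [dense_iff_inter_open]
  intro O hO ⟨x, hx⟩
  obtain ⟨k, v, rfl⟩ := hsurj x
  have hO' : IsOpen ((e k).base ⁻¹' O) := hO.preimage (e k).continuous
  obtain ⟨v', hv'O, hv'⟩ := (dense_iff_inter_open.1 (hdense k)) _ hO' ⟨v, hx⟩
  refine ⟨(e k).base v', hv'O, ?_⟩
  -- `v' ∉ V(e_k^* J) = e_k⁻¹ V(J)`
  have h1 : v' ∉ ((J.comap (e k)).support : Set (V k)) := hv'
  rw [Scheme.IdealSheafData.support_comap] at h1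
  exact h1

/-- **A blowing up is a resolution of singularities if it is so after a flat covering base
change.** For `π : X' → X` a blowing up along an ideal sheaf `J` of finite type with `X'` locally
Noetherian, and flat `e_k : V_k → X` jointly surjective: if every blowing up of `V_k` along
`e_k^* J` has regular source and the centres `V(e_k^* J)` are nowhere dense, then `π` is proper,
birational and `X'` is regular. [cite: GortzWedhorn2020, Prop. 13.91 (2)–(4)]
[cite: Matsumura1987, Thm. 23.7 (i)] -/
theorem IsBlowup.isResolution_of_flat_cover [IsLocallyNoetherian X'] (hπ : IsBlowup π J)
    [∀ k, Flat (e k)] (hsurj : ∀ x : X, ∃ (k : κ) (v : V k), (e k).base v = x)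
    (hfg : ∀ U : X.affineOpens, (J.ideal U).FG)
    (hdense : ∀ k, Dense ((centreCompl (J.comap (e k)) : (V k).Opens) : Set (V k)))
    (hreg : ∀ (k : κ) {P : Scheme.{u}} (q : P ⟶ V k), IsBlowup q (J.comap (e k)) →
      Scheme.IsRegular P) :
    IsResolution π :=
  hπ.isResolution_of_dense hfg (dense_centreCompl_of_cover e J hsurj hdense)
    (hπ.isRegular_of_flat_cover e hsurj hreg)

end Literature.AlgebraicGeometry.Resolution

end
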